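import Literature.AlgebraicGeometry.Frobenioids.RealificationMapInjectiveCountableSupp
import Literature.AlgebraicGeometry.Frobenioids.RealificationMapInjectiveOnePrimeWeak
import HarnessLib

/-!
# Frobenioids I, Def. 2.4 (i) / Prop. 5.3 — injectivity of homomorphisms `M^rlf → N^rlf` over `f^pf` under disjoint
# supports and COUNTABLE supports: the WEAK vocabulary (`IsPerfFactorialWeak`)

Mochizuki, *The geometry of Frobenioids I*, Kyushu J. Math. **62** (2008), Def. 2.4 (i) p. 48 (the
realification `M^rlf ⊆ ∏_𝔮 M^rlf_𝔮`), Prop. 5.3 p. 103 l. 12 ("the divisor monoid `Φ^rlf`")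
[cite: MochizukiFrdI2008, Def. 2.4(i) p.48] [cite: MochizukiFrdI2008, Prop. 5.3 p.103].

Weak-vocabulary twin (cell abc-iut, seat abc-iut-w5-d153 gen 4) of `RealificationMapInjectiveCountableSupp.lean`
(this seat, strong vocabulary): for weakly perf-factorial `M`, `N` (`PerfFactorialWeak.lean`, the vocabulary of record
for the divisor monoids of [EtTh] §3) and ANY homomorphism `φ : M^rlf → N^rlf` over `f^pf` (e.g. `rlfMapWeak`):
* `apply_eq_one_of_forall_restrict_of_finset` / **`apply_eq_one_of_forall_restrict_of_countable`** — `φ` is computed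
  prime by prime on countably supported elements (head = finite case; tail `(x_{≥n})ⁿ ∣ y := (x_𝔮^{i(𝔮)+1})_𝔮` for
  every `n`, and `N^rlf_𝔯 ≅ ℝ_{≥0}` is archimedean: `Realification.eq_one_of_forall_pow_dvd`);
* **`eq_of_apply_eq_of_countable`**, **`injective_of_disjoint_supp_of_countable`**, `…_of_countable_primes` — `φ` is
  injective provided `f` is injective, primary elements of distinct primes of `M^pf` are sent to elements of `N^rlf`
  with disjoint supports, and supports in `M^pf` are countable (resp. `Prime(M^pf)` is countable).
Proof-only (no definitions); one-prime lemmas from `RealificationMapInjectiveOnePrimeWeak.lean`.  Nothing here bears on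
[IUTchIII] Cor. 3.12 (L1 = [FrdI], refereed); the consumer is the binder `hBinj` of [EtTh] Def. 3.6 (i) at `Λ = ℝ` in
the weak vocabulary (`RealifiedDivisorMonoids.ofRlfRWeak`).
-/

noncomputable section

namespace Literature.AlgebraicGeometry.Frobenioids

open Function Literature.AnabelianGeometry.EtaleTheta
open IsPerfFactorial (single' single'_apply_same single'_apply_of_ne single'_one)

universe w

namespace IsPerfFactorialWeak

namespace Rlf

variable {M : Type w} [CommMonoid M] {N : Type w} [CommMonoid N]
variable {f : M →* N}

/-! ### Homomorphisms out of `M^rlf` are computed prime by prime on countably supported elements -/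

/-- **Finite case**: if `Supp(x) ⊆ s` (finite) and every `φ(x|_𝔭)`, `𝔭 ∈ s`, has trivial `𝔯`-component, then
so does `φ(x)`. [cite: MochizukiFrdI2008, Prop. 5.3 p.103] -/
theorem apply_eq_one_of_forall_restrict_of_finset (hM : IsPerfFactorialWeak M) (hN : IsPerfFactorialWeak N) (φ : hM.Rlf →* hN.Rlf) (𝔯 : Primes (Perfection N))
    (s : Finset (Primes (Perfection M))) :
    ∀ x : hM.Rlf, supp (x : RlfFactor M) ⊆ ↑s →
      (∀ 𝔭 ∈ s, (φ (hM.restrict 𝔭 x) : RlfFactor N) 𝔯 = 1) → (φ x : RlfFactor N) 𝔯 = 1 := by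
  classical
  induction s using Finset.induction with
  | empty =>
    intro x hx _
    have hx1 : x = 1 := by
      by_contra hne
      obtain ⟨𝔮, h𝔮⟩ := (ne_one_iff_supp_nonempty hM x).mp hne
      simpa using hx h𝔮
    rw [hx1, map_one, coe_one, Pi.one_apply]
  | insert 𝔭 s h𝔭s ih =>
    intro x hx hres
    obtain ⟨x', hxx', hx'𝔭, hx's⟩ := exists_eq_restrict_mul hM x 𝔭
    have hx'sub : supp (x' : RlfFactor M) ⊆ ↑s := by
      intro 𝔮 h𝔮
      have h1 : 𝔮 ∈ insert 𝔭 s := by simpa using hx (hx's h𝔮)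
      rcases Finset.mem_insert.mp h1 with h2 | h2
      · subst h2
        exact (h𝔮 hx'𝔭).elim
      · simpa using h2
    have hres' : ∀ 𝔮 ∈ s, (φ (hM.restrict 𝔮 x') : RlfFactor N) 𝔯 = 1 := by
      intro 𝔮 h𝔮
      have hne : 𝔮 ≠ 𝔭 := by
        rintro rfl
        exact h𝔭s h𝔮
      rw [restrict_eq_of_eq_restrict_mul hM hxx' hne]
      exact hres 𝔮 (Finset.mem_insert_of_mem h𝔮)
    have h1 := hres 𝔭 (Finset.mem_insert_self _ _)
    rw [hxx', map_mul, coe_mul, Pi.mul_apply, h1, one_mul]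
    exact ih x' hx'sub hres'

/-- **Countable case**: for ANY homomorphism `φ : M^rlf → N^rlf`, any `x ∈ M^rlf` with COUNTABLE support and any prime
`𝔯` of `N^pf`: if every single-prime piece `φ(x|_𝔭)` has trivial `𝔯`-component, then so does `φ(x)` (head = finite
case; tail `(x_{≥n})ⁿ ∣ y := (x_𝔮^{i(𝔮)+1})_𝔮` for all `n`; `N^rlf_𝔯` is archimedean).
[cite: MochizukiFrdI2008, Prop. 5.3 p.103] -/
theorem apply_eq_one_of_forall_restrict_of_countable (hM : IsPerfFactorialWeak M) (hN : IsPerfFactorialWeak N) (φ : hM.Rlf →* hN.Rlf) (𝔯 : Primes (Perfection N))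
    (x : hM.Rlf) (hx : (supp (x : RlfFactor M)).Countable)
    (hres : ∀ 𝔭, (φ (hM.restrict 𝔭 x) : RlfFactor N) 𝔯 = 1) : (φ x : RlfFactor N) 𝔯 = 1 := by
  classical
  by_cases hx1 : x = 1
  · rw [hx1, map_one, coe_one, Pi.one_apply]
  obtain ⟨g, hg⟩ := hx.exists_eq_range ((ne_one_iff_supp_nonempty hM x).mp hx1)
  have hex : ∀ 𝔮, 𝔮 ∈ supp (x : RlfFactor M) → ∃ i, g i = 𝔮 := by
    intro 𝔮 h𝔮
    rw [hg] at h𝔮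
    exact h𝔮
  let idx : Primes (Perfection M) → ℕ := fun 𝔮 =>
    if h𝔮 : 𝔮 ∈ supp (x : RlfFactor M) then Nat.find (hex 𝔮 h𝔮) else 0
  have hidx : ∀ {𝔮}, 𝔮 ∈ supp (x : RlfFactor M) → g (idx 𝔮) = 𝔮 := by
    intro 𝔮 h𝔮
    simp only [idx, dif_pos h𝔮]
    exact Nat.find_spec (hex 𝔮 h𝔮)
  let yv : RlfFactor M := fun 𝔮 => (x : RlfFactor M) 𝔮 ^ (idx 𝔮 + 1)
  have hysupp : supp yv ⊆ supp (x : RlfFactor M) := by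
    intro 𝔮 h𝔮 h1
    exact h𝔮 (by simp only [yv, h1, one_pow])
  let y : hM.Rlf := ⟨yv, mem_realification_of_supp_subset hM x hysupp⟩
  let headv : ℕ → RlfFactor M := fun n 𝔮 => if idx 𝔮 < n then (x : RlfFactor M) 𝔮 else 1
  let tailv : ℕ → RlfFactor M := fun n 𝔮 => if idx 𝔮 < n then 1 else (x : RlfFactor M) 𝔮
  have hheadsupp : ∀ n, supp (headv n) ⊆ supp (x : RlfFactor M) := by
    intro n 𝔮 h𝔮 h1
    exact h𝔮 (by simp only [headv, h1, ite_self])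
  have htailsupp : ∀ n, supp (tailv n) ⊆ supp (x : RlfFactor M) := by
    intro n 𝔮 h𝔮 h1
    exact h𝔮 (by simp only [tailv, h1, ite_self])
  let head : ℕ → hM.Rlf := fun n => ⟨headv n, mem_realification_of_supp_subset hM x (hheadsupp n)⟩
  let tail : ℕ → hM.Rlf := fun n => ⟨tailv n, mem_realification_of_supp_subset hM x (htailsupp n)⟩
  have hsplit : ∀ n, x = head n * tail n := by
    intro n
    apply Subtype.ext
    funext 𝔮
    change (x : RlfFactor M) 𝔮 = headv n 𝔮 * tailv n 𝔮
    by_cases h : idx 𝔮 < n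
    · simp only [headv, tailv, if_pos h, mul_one]
    · simp only [headv, tailv, if_neg h, one_mul]
  have hhead : ∀ n, (φ (head n) : RlfFactor N) 𝔯 = 1 := by
    intro n
    refine apply_eq_one_of_forall_restrict_of_finset hM hN φ 𝔯 ((Finset.range n).image g) (head n) ?_ ?_
    · intro 𝔮 h𝔮
      have hx𝔮 : 𝔮 ∈ supp (x : RlfFactor M) := hheadsupp n h𝔮
      have hlt : idx 𝔮 < n := by
        by_contra hlt
        exact h𝔮 (by simp only [head, headv, if_neg hlt])
      rw [Finset.coe_image, Finset.coe_range]
      exact ⟨idx 𝔮, hlt, hidx hx𝔮⟩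
    · intro 𝔭 _
      by_cases h : idx 𝔭 < n
      · have heq : (head n : RlfFactor M) 𝔭 = (x : RlfFactor M) 𝔭 := by simp only [head, headv, if_pos h]
        rw [restrict_eq_restrict_of_apply_eq hM heq]
        exact hres 𝔭
      · have heq : (head n : RlfFactor M) 𝔭 = 1 := by simp only [head, headv, if_neg h]
        rw [restrict_eq_one_of_apply_eq_one hM heq, map_one, coe_one, Pi.one_apply]
  have htail : ∀ n, (φ (tail n) : RlfFactor N) 𝔯 = (φ x : RlfFactor N) 𝔯 := by
    intro n
    conv_rhs => rw [hsplit n, map_mul, coe_mul, Pi.mul_apply, hhead n, one_mul]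
  have hdvd : ∀ n, tail n ^ n ∣ y := by
    intro n
    let cv : RlfFactor M := fun 𝔮 =>
      if idx 𝔮 < n then (x : RlfFactor M) 𝔮 ^ (idx 𝔮 + 1) else (x : RlfFactor M) 𝔮 ^ (idx 𝔮 + 1 - n)
    have hcsupp : supp cv ⊆ supp (x : RlfFactor M) := by
      intro 𝔮 h𝔮 h1
      apply h𝔮
      by_cases h : idx 𝔮 < n
      · simp only [cv, if_pos h, h1, one_pow]
      · simp only [cv, if_neg h, h1, one_pow]
    refine ⟨⟨cv, mem_realification_of_supp_subset hM x hcsupp⟩, Subtype.ext ?_⟩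
    funext 𝔮
    change yv 𝔮 = (tailv n ^ n * cv) 𝔮
    rw [Pi.mul_apply, Pi.pow_apply]
    by_cases h : idx 𝔮 < n
    · simp only [yv, tailv, cv, if_pos h, one_pow, one_mul]
    · simp only [yv, tailv, cv, if_neg h, ← pow_add]
      congr 1
      omega
  apply Realification.eq_one_of_forall_pow_dvd (u := (φ y : RlfFactor N) 𝔯)
  intro n
  obtain ⟨c, hc⟩ := hdvd n
  refine ⟨(φ c : RlfFactor N) 𝔯, ?_⟩
  rw [← htail n, ← Pi.pow_apply, ← Pi.mul_apply, ← coe_pow, ← coe_mul, ← map_pow, ← map_mul, ← hc]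

/-! ### Injectivity on countably supported elements -/

/-- **`φ x = φ y ⇒ x = y` for countably supported `x, y ∈ M^rlf`** (`φ` over `f^pf`, `f` injective, primary elements of
distinct primes with disjointly supported images): at a prime `𝔯` in the support of the image of a primary `p ∈ 𝔭`
the remainder `x'` of `x = x|_𝔭 · x'` contributes nothing, so `φ(x|_𝔭) = φ(y|_𝔭)`, whence `x|_𝔭 = y|_𝔭` for
every `𝔭`. [cite: MochizukiFrdI2008, Prop. 5.3 p.103] -/
theorem eq_of_apply_eq_of_countable (hM : IsPerfFactorialWeak M) (hN : IsPerfFactorialWeak N) (φ : hM.Rlf →* hN.Rlf)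
    (hφ : ∀ a : Perfection M, φ (hM.toRealification a) = hN.toRealification (Perfection.map f a))
    (hf : Injective f)
    (hdisj : ∀ (𝔭 𝔮 : Primes (Perfection M)), 𝔭 ≠ 𝔮 → ∀ x ∈ 𝔭.carrier, ∀ y ∈ 𝔮.carrier,
      Disjoint (supp (hN.toRealification (Perfection.map f x) : RlfFactor N))
        (supp (hN.toRealification (Perfection.map f y) : RlfFactor N)))
    {x y : hM.Rlf} (hx : (supp (x : RlfFactor M)).Countable) (hy : (supp (y : RlfFactor M)).Countable)
    (hxy : φ x = φ y) : x = y := by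
  classical
  apply eq_of_forall_restrict_eq hM
  intro 𝔭
  apply restrict_eq_of_apply_restrict_eq hM hN φ hφ hf
  obtain ⟨⟨p, hp'⟩, hp⟩ := Quotient.exists_rep 𝔭
  have hpc : p ∈ 𝔭.carrier := ⟨hp', hp⟩
  have havoid : ∀ {z z' : hM.Rlf}, (supp (z : RlfFactor M)).Countable → z = hM.restrict 𝔭 z * z' →
      (z' : RlfFactor M) 𝔭 = 1 → supp (z' : RlfFactor M) ⊆ supp (z : RlfFactor M) →
        ∀ 𝔯 ∈ supp (hN.toRealification (Perfection.map f p) : RlfFactor N), (φ z' : RlfFactor N) 𝔯 = 1 := by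
    intro z z' hz hzz' hz'𝔭 hz's 𝔯 h𝔯
    refine apply_eq_one_of_forall_restrict_of_countable hM hN φ 𝔯 z' (hz.mono hz's) ?_
    intro 𝔮
    by_cases h𝔮𝔭 : 𝔮 = 𝔭
    · subst h𝔮𝔭
      rw [restrict_eq_one_of_apply_eq_one hM hz'𝔭, map_one, coe_one, Pi.one_apply]
    · obtain ⟨⟨q, hq'⟩, hq⟩ := Quotient.exists_rep 𝔮
      have hqc : q ∈ 𝔮.carrier := ⟨hq', hq⟩
      by_contra hne
      have h1 := supp_apply_restrict_subset hM hN φ hφ z' hqc hne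
      exact Set.disjoint_left.mp (hdisj 𝔭 𝔮 (Ne.symm h𝔮𝔭) p hpc q hqc) h𝔯 h1
  obtain ⟨x', hxx', hx'𝔭, hx's⟩ := exists_eq_restrict_mul hM x 𝔭
  obtain ⟨y', hyy', hy'𝔭, hy's⟩ := exists_eq_restrict_mul hM y 𝔭
  apply Subtype.ext
  funext 𝔯
  have ex : ((φ x : hN.Rlf) : RlfFactor N) 𝔯 = ((φ y : hN.Rlf) : RlfFactor N) 𝔯 := by rw [hxy]
  by_cases h𝔯 : 𝔯 ∈ supp (hN.toRealification (Perfection.map f p) : RlfFactor N)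
  · rw [hxx', hyy', map_mul, map_mul, coe_mul, coe_mul, Pi.mul_apply, Pi.mul_apply,
      havoid hx hxx' hx'𝔭 hx's 𝔯 h𝔯, havoid hy hyy' hy'𝔭 hy's 𝔯 h𝔯, mul_one, mul_one] at ex
    exact ex
  · have h1 : ∀ z : hM.Rlf, (φ (hM.restrict 𝔭 z) : RlfFactor N) 𝔯 = 1 := by
      intro z
      by_contra hne
      exact h𝔯 (supp_apply_restrict_subset hM hN φ hφ z hpc hne)
    rw [h1 x, h1 y]

/-- **Injectivity of a homomorphism `φ : M^rlf → N^rlf` over `f^pf`, weak vocabulary, COUNTABLE supports**: `f`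
injective, primary elements of distinct primes of `M^pf` with disjointly supported images in `N^rlf`, every element of
`M^pf` countably supported ⟹ `φ` injective (row P53/L02a′ beyond finite support, for the divisor monoids of [EtTh] §3).
[cite: MochizukiFrdI2008, Prop. 5.3 p.103] -/
theorem injective_of_disjoint_supp_of_countable (hM : IsPerfFactorialWeak M) (hN : IsPerfFactorialWeak N) (φ : hM.Rlf →* hN.Rlf)
    (hφ : ∀ a : Perfection M, φ (hM.toRealification a) = hN.toRealification (Perfection.map f a))
    (hf : Injective f)
    (hdisj : ∀ (𝔭 𝔮 : Primes (Perfection M)), 𝔭 ≠ 𝔮 → ∀ x ∈ 𝔭.carrier, ∀ y ∈ 𝔮.carrier,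
      Disjoint (supp (hN.toRealification (Perfection.map f x) : RlfFactor N))
        (supp (hN.toRealification (Perfection.map f y) : RlfFactor N)))
    (hcnt : ∀ a : Perfection M, (supp (factorMap M a)).Countable) : Injective φ := by
  intro x y hxy
  obtain ⟨bx, hbx⟩ := x.2
  obtain ⟨by_, hby⟩ := y.2
  exact eq_of_apply_eq_of_countable hM hN φ hφ hf hdisj ((hcnt bx).mono hbx) ((hcnt by_).mono hby) hxy

/-- The same when `Prime(M^pf)` is countable. [cite: MochizukiFrdI2008, Prop. 5.3 p.103] -/
theorem injective_of_disjoint_supp_of_countable_primes (hM : IsPerfFactorialWeak M) (hN : IsPerfFactorialWeak N) (φ : hM.Rlf →* hN.Rlf) [Countable (Primes (Perfection M))]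
    (hφ : ∀ a : Perfection M, φ (hM.toRealification a) = hN.toRealification (Perfection.map f a))
    (hf : Injective f)
    (hdisj : ∀ (𝔭 𝔮 : Primes (Perfection M)), 𝔭 ≠ 𝔮 → ∀ x ∈ 𝔭.carrier, ∀ y ∈ 𝔮.carrier,
      Disjoint (supp (hN.toRealification (Perfection.map f x) : RlfFactor N))
        (supp (hN.toRealification (Perfection.map f y) : RlfFactor N))) : Injective φ :=
  fun _ _ hxy => eq_of_apply_eq_of_countable hM hN φ hφ hf hdisj (Set.to_countable _) (Set.to_countable _) hxy

end Rlf

end IsPerfFactorialWeak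

end Literature.AlgebraicGeometry.Frobenioids

end
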